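import Summits.BirchSwinnertonDyer.BirchSwinnertonDyer.Theorems.SchneiderFreeAdditiveX3AnticycControlAdditiveK
import HarnessLib

/-!
# Record item `AnticycControlAdditive` (route `SchneiderFreeAdditiveX3`, item stmt-BirchSwinnertonDyer-19178) ⟸ Kolyvagin ALONE

Cell `bsd-schneider-ideate`, seat `bsd-schneider-door-c4` (prover, generation 20).  PARTITION: board row B6 ∩ X3 ∩ sst-twist,
`r = 1`, of `Rank1Residual.partition` — CONTROL corner.  bears_on: K1-door (r1, B6∩X3-sst)
(route-BirchSwinnertonDyer-SchneiderFreeAdditiveX3 items 18969 → 19178 → 19295).  Supports item 19178 WITHOUT closing it.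

Item 19178 `AnticycControlAdditive` is the rev-3, fact-free form of the control corner: `∀ E p, r_an = 1 → p ≠ 2 → ClassX3 →
SubSemistableTwist → SchneiderFree.AdditiveControlInputManinAt E p`.  It was superseded at rev 6 by the Kolyvagin-prefixed
re-typing `AnticycControlAdditiveK` (item 19295: `(∀ N W K, kolyvagin N W K) → <the same body>`), because every in-tree proof of
the control equality consumes Kolyvagin's theorem (rank `E(K) = 1` and `#Ш(E/K)[p^∞] < ∞` for a non-torsion Heegner point —
the cite-only fact `Literature.NumberTheory.EllipticCurves.kolyvagin`; door-c2 FINDING F2, door-c6 g18/g19 evidence on 19295).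
Item 19295 is CLOSED·proved (`anticycControlAdditiveK_proof`, door-c4 g19, 2026-08-28).  This file records, as tree theorems,
the two implications between the record and its repair:
* `anticycControlAdditive_of_kolyvagin` — **19178 follows from Kolyvagin's theorem ALONE** (`:= anticycControlAdditiveK_proof hKo`;
  CONDITIONAL by design: the named cite-only fact is its one hypothesis, taken BY NAME);
* `anticycControlAdditiveK_of_anticycControlAdditive` — the fact-free record implies the repaired crux (`fun h _ => h`).
So the ledger state of 19178 is exact: it is provable in-tree if and only if `kolyvagin` is, and nothing else stands between them.

HONEST FRAMING: no new mathematics; a conditional result (the gate records `proof.conditional` on the Kolyvagin binder); item 19178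
stays OPEN (it closes only with an in-tree proof of Kolyvagin's theorem); BSD is NOT advanced.
References: [Gross1991] Thm. 1.3; [Kolyvagin1990]; [JetchevSkinnerWan2017] Thm. 3.3.1.
-/

noncomputable section

-- `Summit.<P>.<Sub>` repeats `BirchSwinnertonDyer` by the tree's layout convention (D-0017)
set_option linter.dupNamespace false

namespace Summit.BirchSwinnertonDyer.BirchSwinnertonDyer.Theorems.SchneiderFreeAdditiveX3

/-- **Item 19178 `AnticycControlAdditive` from Kolyvagin's theorem alone**: the fact-free anticyclotomic control record on
B6 ∩ X3 ∩ sst-twist, `r_an = 1`, `p` odd, follows from the cite-only fact `kolyvagin` (Gross 1991 Thm. 1.3) by the closed crux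
`anticycControlAdditiveK_proof` (item 19295).  CONDITIONAL on that named fact, which is NOT proved here.
[cite: Gross1991, Thm. 1.3][cite: JetchevSkinnerWan2017, Thm. 3.3.1 (arXiv:1512.06894 p. 11)] -/
theorem anticycControlAdditive_of_kolyvagin
    (hKo : ∀ (N : ℕ) [NeZero N] (W : WeierstrassCurve ℚ) (K : Type) [Field K] [NumberField K],
      Literature.NumberTheory.EllipticCurves.kolyvagin N W K) :
    Summit.BirchSwinnertonDyer.BirchSwinnertonDyer.Theses.SchneiderFreeAdditiveX3.AnticycControlAdditive :=
  anticycControlAdditiveK_proof hKo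

/-- The fact-free record `AnticycControlAdditive` (item 19178) implies its Kolyvagin-prefixed repair `AnticycControlAdditiveK`
(item 19295) by discarding the antecedent. [folklore] -/
theorem anticycControlAdditiveK_of_anticycControlAdditive
    (h : Summit.BirchSwinnertonDyer.BirchSwinnertonDyer.Theses.SchneiderFreeAdditiveX3.AnticycControlAdditive) :
    Summit.BirchSwinnertonDyer.BirchSwinnertonDyer.Theses.SchneiderFreeAdditiveX3.AnticycControlAdditiveK :=
  fun _ => h

end Summit.BirchSwinnertonDyer.BirchSwinnertonDyer.Theorems.SchneiderFreeAdditiveX3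

end
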